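import Literature.NumberTheory.Sieve.BombieriAsymptoticSievePrDistribution
import Literature.NumberTheory.Sieve.RoughCellDensity
import HarnessLib

/-!
# Bombieri's asymptotic sieve: the distribution of a sifted sequence on `P_r`, every `r ≥ 2`,
# against test functions of the smallest prime factor

Topic `Literature/NumberTheory/Sieve`, family `parity`; companion of
`BombieriAsymptoticSievePrDistribution.lean` (the case `r = 2`, `Bombieri1976_P2Distribution`,
PROVED in the tree as `Bombieri1976_P2Distribution_holds`). Source: E. Bombieri, *The asymptotic
sieve*, RIMS Kôkyûroku **294** (1977) 1–8, notes by Y. Motohashi [BombieriRIMS1977], p. 5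
Theorem (all `r`), with the definitions of pp. 4–5 and the meaning of `∼` fixed by the Corollary
on p. 6; full proof: Rend. Accad. Naz. XL (5) 1/2 (1975/76) 243–269 [BombieriAsymptoticSieve1976]
(not held); restated in E. Bombieri, *Sieve methods* (Selberg Symposium, Oslo 1987), Academic Press
1989, §3.2 Theorem p. 39–40 (`T₁^±(w) = W⁺ ± |W⁻|`, `W^± = Σ_h (±1)^h ∫_{U_h} w_h du₁/u₁ ⋯
du_{h−1}/u_{h−1}`, "If `W⁻ = 0` we get asymptotics"), held: book:editor1989-number-theory-trace-formulas
pp. 38–40.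

## What is printed ([BombieriRIMS1977] pp. 4–6)

For `r ≥ 2`, `T_r = {0 < u₁ ≤ ⋯ ≤ u_r < 1, u₁ + ⋯ + u_r = 1}` with `dμ_r = du₁⋯du_{r−1}/(u₁⋯u_r)`;
for `G` continuous on `T_r`, `G*(p₁⋯p_r) = G(log p₁/log n, …, log p_r/log n)` on `P_r` (squarefree
`n` with exactly `r` prime factors); `δ_x` is defined by `∑_{p ≤ x} a_p = δ_x H A(x)/log x`.
**Theorem (Bombieri).** Under (A₁)–(A₅), for every `r`, `{a_n}` has on `P_r` the distribution
function `γ_x ≡ δ_x` (`r` odd), `γ_x ≡ 2 − δ_x` (`r` even):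
`∑_{n ≤ x, n ∈ P_r} a_n G*(n) ∼ γ_x (∫_{T_r} G dμ_r) H A(x)/log x`, the `∼` with the `x`-dependent
factor meaning an additive error `o(H A(x)/log x)` (p. 6 Corollary; `H > 0` under (A₁), (A₅)).

## What is vendored here, and how faithfully

`Bombieri1976_PrDistributionMin`: the Theorem for every `r ≥ 2` and the SUB-CLASS of test
functions depending on the SMALLEST coordinate only, `G(u) = g(u₁)` with `g : ℝ → ℝ` continuous and
vanishing on `(−∞, η]` for some `η > 0` (weaker than print: such `G` are continuous on `T_r`, indeed
`G/(u₁⋯u_r)` is continuous there as p. 6 allows). For such `G` the simplex integral is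
one-dimensional. Write `w = 1/u₁ ∈ [r, ∞)`. Conditioning `μ_r` on the smallest coordinate: for fixed
`u₁`, the remaining coordinates `(u₂,…,u_r)`, rescaled by `1/(1 − u₁)`, range over `T_{r−1}` subject
to "smallest coordinate `≥ u₁/(1 − u₁) = 1/(w − 1)`", and
`dμ_r = (du₁/(u₁(1 − u₁))) · dμ_{r−1}(rescaled)` (the Jacobian `(1 − u₁)^{r−2}` of the rescaling
against the factor `(1 − u₁)^{r−1}` of `u₂⋯u_r`). Since `du₁/(u₁(1−u₁)) = dw/(w − 1)` (`u₁ = 1/w`) and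
`μ_{r−1}(T_{r−1} ∩ {min ≥ 1/v}) = I_{r−1}(v)` — Buchstab–Alladi's cell density of the rough
integers, tree `roughCellDensity` (`RoughCellDensity.lean`; e.g. `μ₁ = ` Dirac at `1` gives
`I₁ ≡ 1` on `[1,∞)`, `μ₂(T₂ ∩ {u₁ ≥ 1/v}) = ∫_{1/v}^{1/2} du/(u(1−u)) = log(v − 1) = I₂(v)`, and
inductively by the same conditioning) — one gets

  `∫_{T_r} g(u₁) dμ_r(u) = ∫_{1}^{∞} g(1/w) · I_{r−1}(w − 1)/(w − 1) dw =: bombieriMinWeight r g`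

(the integrand vanishes for `w < r` and for `w > 1/η`). Consistency checks (not used anywhere):
(i) `r = 2`: the kernel is `1_{w ≥ 2}/(w − 1)` and `u = 1/w` turns `∫_{w ≥ 2} g(1/w) dw/(w−1)` into
`∫₀^{1/2} g(u) du/(u(1 − u))`, the integral of the tree's `Bombieri1976_P2Distribution` — so at
`r = 2` the statement below IS the vetted `P₂` fact for the same `g`; (ii) `g ↑ 1_{[1/U, ∞)}`:
`bombieriMinWeight r g → ∫_1^U I_{r−1}(w−1) dw/(w−1) = I_r(U)` (tree
`roughCellDensity_succ_succ_eq_integral_sub`), and for `a_n ≡ 1` (`H = 1`, `δ_x → 1`) the Theorem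
then reads `#{n ≤ x : n ∈ P_r, p_min(n) > x^{1/U}} ∼ I_r(U) x/log x`, which is Alladi's theorem
(K. Alladi, Quart. J. Math. Oxford 33 (1982); tree `exists_abs_cell_sub_main_le`).
As in the `P₂` file, the printed `∼` is vendored division-free: substituting
`δ_x H A(x)/log x = ∑_{p ≤ x} a_p`,
  `r` odd:  `∑_{P_r} a_n g(u₁) − Φ ∑_{p ≤ x} a_p = o(A(x)/log x)`,
  `r` even: `∑_{P_r} a_n g(u₁) + Φ ∑_{p ≤ x} a_p − 2 Φ H A(x)/log x = o(A(x)/log x)`,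
`Φ = bombieriMinWeight r g`, both written at once with the sign `(−1)^r`. `P_r ∩ [1, x]` is the set
of squarefree `n ≤ ⌊x⌋` with `ω(n) = r`, and `u₁ = log p_min(n)/log n` with `p_min = Nat.minFac`.

Deliberately NOT here: test functions of all coordinates (the full printed class), the case `r = 1`
(the definition of `δ_x`), and any proof (the deduction from the tree's PROVED
`Bombieri1976_asymptotic_sieve_vector_holds` follows [FriedlanderIwaniecPisa1978] p. 723 Remark 4,
as carried out for `r = 2` in `BombieriAsymptoticSievePrDistributionProofs.lean`). Consumer: the
`Parity/BatemanHorn` crux `OddSectorShareLinear` (stmt-Parity-15629), whose GEH-conditional layer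
needs the odd cells `r = 3, 5, …` of Bombieri sequences (the ghost `δ_x` cancels inside the odd
sector).
-/

noncomputable section

open Filter Asymptotics Finset
open scoped _root_.Topology ArithmeticFunction.omega

namespace Literature.NumberTheory.Sieve

/-- **Bombieri's measure `μ_r` integrated against a function of the smallest coordinate**:
`bombieriMinWeight r g = ∫_{T_r} g(u₁) dμ_r(u) = ∫_{w > 1} g(1/w) · I_{r−1}(w − 1)/(w − 1) dw`
(`w = 1/u₁`; `I_j = roughCellDensity j`, Buchstab–Alladi's cell densities; see the module docstring
for the conditioning-on-`u₁` computation). For `r ≥ 2` the integrand vanishes on `(1, r)` (as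
`I_{r−1}(w − 1) = 0` for `w − 1 < r − 1`), so there is no singularity at `w = 1`, and it vanishes for
`w > 1/η` when `g = 0` on `(−∞, η]`. For `g = 1_{[1/U,∞)}` its value is `I_r(U)`.
[cite: BombieriRIMS1977, p. 4 (definition of T_r and dμ_r) and p. 5 (distribution function)] -/
def bombieriMinWeight (r : ℕ) (g : ℝ → ℝ) : ℝ :=
  ∫ w in Set.Ioi (1 : ℝ), g (1 / w) * (roughCellDensity (r - 1) (w - 1) / (w - 1))

/-- **Bombieri's asymptotic sieve on `P_r`, every `r ≥ 2`, for test functions of the smallest prime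
factor** — [BombieriRIMS1977] p. 5, Theorem (with the definitions of pp. 4–5 and the meaning of `∼`
fixed by the Corollary on p. 6; full proof announced there as [BombieriAsymptoticSieve1976]; restated
[Bombieri1989SieveMethods] §3.2). Printed: if `{a_n}` satisfies (A₁)–(A₅) then on `P_r` it has the
distribution function `γ_x ≡ δ_x` for odd `r` and `γ_x ≡ 2 − δ_x` for even `r` against
`dμ_r = du₁⋯du_{r−1}/(u₁⋯u_r)` on `T_r`, i.e. for every continuous test function `G` on `T_r`,
`∑_{n ≤ x, n ∈ P_r} a_n G*(n) ∼ γ_x (∫_{T_r} G dμ_r) H A(x)/log x`, where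
`∑_{p ≤ x} a_p = δ_x H A(x)/log x` defines `δ_x` and `H = ∏_p (p/(p−1))(1 − 1/f(p))`.
Vendored (see the module docstring for why this is implied by, never stronger than, the print): for
every sieve sequence `A` with Bombieri's (A₁)–(A₅) (`A.IsBombieriSequence`) and density constant `H`
(`A.HasDensityConstant H`), every `r ≥ 2`, and every continuous `g : ℝ → ℝ` vanishing on `(−∞, η]`
for some `η > 0`, writing `Φ = bombieriMinWeight r g = ∫_{T_r} g(u₁) dμ_r` and
`u₁(n) = log p_min(n)/log n`,
`∑_{n ≤ x, n squarefree, ω(n) = r} a_n g(u₁(n)) + (−1)^r Φ ∑_{p ≤ x} a_p − (1 + (−1)^r) Φ H A(x)/log x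
= o(A(x)/log x)` as `x → ∞` (odd `r`: `∼ δ_x Φ H A/log x`; even `r`: `∼ (2 − δ_x) Φ H A/log x`).
At `r = 2` this is the tree's `Bombieri1976_P2Distribution` (substitute `u = 1/w`).
[cite: BombieriRIMS1977, p. 5 Theorem (every r); definitions pp. 4-5; meaning of ∼ p. 6 Corollary] [cite: BombieriAsymptoticSieve1976, Theorem] -/
def Bombieri1976_PrDistributionMin : Prop :=
  ∀ (A : SieveSequence) (H : ℝ), A.IsBombieriSequence → A.HasDensityConstant H →
    ∀ r : ℕ, 2 ≤ r → ∀ g : ℝ → ℝ, Continuous g → (∃ η : ℝ, 0 < η ∧ ∀ u : ℝ, u ≤ η → g u = 0) →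
      (fun x : ℝ =>
          (∑ n ∈ (Finset.Icc 1 ⌊x⌋₊).filter (fun n : ℕ => Squarefree n ∧ ω n = r),
              A.a n * g (Real.log (Nat.minFac n) / Real.log n)) +
            (-1 : ℝ) ^ r * bombieriMinWeight r g * (∑ p ∈ Nat.primesLE ⌊x⌋₊, A.a p) -
            (1 + (-1 : ℝ) ^ r) * bombieriMinWeight r g * H * A.size x / Real.log x)
        =o[atTop] fun x : ℝ => A.size x / Real.log x

end Literature.NumberTheory.Sieve

end
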